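import Mathlib
import HarnessLib
import Summits.HubbardSuperconductivity.HubbardSuperconductivity.Theorems.KLProgrammeC4aSliceIncrementAssembly

/-!
# Route `KLProgramme` — crux C4a, the (A)-closer with a REFERENCE (θ-blind) VERTEX SUBTRACTED: the Hartree split of memo §12.3′ WITHOUT position kernels —
# jets of the one-line term are those of the tube tadpole of `V_{p₀} − V★_{p₀}` (`V★_{p₀}(q)` any smooth function not reading the external point), so the
# (L3) dominators are asked of the SUBTRACTED vertex only; the (A) capstone in this form

Cell `gate-hubbard-kl`, lane hubbard-kl-c4a-1 (g5); helper for stub (C) `stub_twoLeg_curvature` of the engine-flow child `KLRegimeEngineV17F2`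
(stmt-HubbardSuperconductivity-20437); memo HOME/hubbard-kl-c4a-1/C4A-PLAN.md §12.3′ (Hartree split), §22.  The tube tadpole-jet theorem bounds the jets of
`T_V(θ) = ∫_{tube} f(e_K q)V(Φ(0,θ), q)dq` by Leibniz on `J·V`, so a θ-BLIND part of the vertex (the bare `U`, value `O(|U|)`) enters the `i = j` line although its
tadpole is θ-CONSTANT (`tubeTadpole_const_vertex`).  Cure: for any smooth `V★ : Momentum → ℂ`, `T_V = T_{V−V★} + const`, so for `j ≥ 1` the jets of `T_V` are those
of `T_{V−V★}` and the (L3) input is `CoMovingJetsL1 N aV r μ K (V − V★)` — with `V★_{p₀} := V_{p₀}(P★, ·)` at a reference external point the bare part cancels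
exactly and no position-space kernel of the bare vertex is needed.

* §1 `integrableOn_tube_of_continuous'` (momentum tube), **`iteratedDeriv_tubeTadpole_eq_sub_blind`** (`∂ʲT_V = ∂ʲT_{V−V★}`, `j ≥ 1`);
* §2 **`abs_iteratedDeriv_re_tadpoleCont_comp_le_ref`** — `…C4aTadpoleJetAssembly.abs_iteratedDeriv_re_tadpoleCont_comp_le` for `1 ≤ j ≤ N` with the
  hypothesis `CoMovingJetsL1 N (aV p₀) r μ K (fun k q => tadpoleVertex β W p₀ k q − Vstar p₀ q)`;
* §3 **`twoLegCurveJetBound_succ_of_inputs_ref`** — the (A) capstone (`…C4aSliceIncrementAssembly.twoLegCurveJetBound_succ_of_inputs_value`) in this form: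
  value line `V₀` (paired bound) + subtracted-vertex jets lines for `1 ≤ k ≤ 4`.

Composition only; nothing is asserted about the Hubbard model's sizes; nothing asserts superconductivity.
References: BGM 2006 §2.4 (2.36)–(2.42) [cite: BenfattoGiulianiMastropietro2006]; FST II CPAM 51 (1998) §3.
-/

noncomputable section

namespace Summit.HubbardSuperconductivity.HubbardSuperconductivity.Theorems.C4a

set_option linter.dupNamespace false -- summit = problem name (single-conjunct summit), D-0017

open Real Set MeasureTheory Finset
open scoped ContDiff
open Literature.MathematicalPhysics.QuantumLattice Literature.MathematicalPhysics.QuantumLattice.BandSectorCounting Literature.Probability.LatticeModels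
open GrassmannAlgebra
open Summit.HubbardSuperconductivity.HubbardSuperconductivity.Theorems.KLRegimeSplit
open Summit.HubbardSuperconductivity.HubbardSuperconductivity.Theorems.KLProgrammeLegKernels
open Summit.HubbardSuperconductivity.HubbardSuperconductivity.Theorems.KLRegimeWick
open Summit.HubbardSuperconductivity.HubbardSuperconductivity.Theorems.DispersionFlow
open Summit.HubbardSuperconductivity.HubbardSuperconductivity.Theorems.PerturbedFermiCurve

/-! ## §1 Subtracting a θ-blind vertex does not change the angular jets of the tube tadpole -/

section Blind

variable {L M : ℕ} [NeZero L] [NeZero M]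

/-- Continuity ⇒ integrability on the momentum tube `{q : |q₁|,|q₂| < π, |e_K(q)| < r}` (compact closure `[-π,π]²`). -/
theorem integrableOn_tube_of_continuous' (μ : ℝ) (K : TrigPolyC4v) (r : ℝ) {g : ℝ × ℝ → ℂ} (hg : Continuous g) :
    IntegrableOn g {q : ℝ × ℝ | |q.1| < π ∧ |q.2| < π ∧ |frameLevel μ K (WithLp.toLp 2 ![q.1, q.2])| < r} := by
  refine (hg.continuousOn.integrableOn_compact (isCompact_Icc.prod isCompact_Icc :
    IsCompact (Icc (-π) π ×ˢ Icc (-π) π : Set (ℝ × ℝ)))).mono_set ?_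
  rintro q ⟨h1, h2, -⟩
  exact ⟨⟨(abs_lt.1 h1).1.le, (abs_lt.1 h1).2.le⟩, ⟨(abs_lt.1 h2).1.le, (abs_lt.1 h2).2.le⟩⟩

/-- The coordinate map `ℝ × ℝ → Momentum` is continuous. -/
theorem continuous_coordToLp : Continuous fun p : ℝ × ℝ => (WithLp.toLp 2 ![p.1, p.2] : Momentum) := by
  refine (PiLp.continuous_toLp 2 _).comp (continuous_pi fun i => ?_)
  fin_cases i
  · exact continuous_fst
  · exact continuous_snd

/-- **Subtracting a θ-blind vertex**: for `V` jointly continuous, `V★ : Momentum → ℂ` continuous, `f` continuous and `j ≥ 1`,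
`∂_θʲ ∫_{tube} f(e_K q)·V(Φ(0,θ), q) dq = ∂_θʲ ∫_{tube} f(e_K q)·(V(Φ(0,θ), q) − V★(q)) dq` (the difference is the θ-free number `∫ f·V★`). -/
theorem iteratedDeriv_tubeTadpole_eq_sub_blind (μ : ℝ) (K : TrigPolyC4v) (r : ℝ) {f : ℝ → ℂ} (hf : Continuous f)
    {V : Momentum → Momentum → ℂ} (hV : Continuous fun x : Momentum × Momentum => V x.1 x.2) {Vstar : Momentum → ℂ} (hVstar : Continuous Vstar)
    {j : ℕ} (hj : 1 ≤ j) (θ : ℝ) :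
    iteratedDeriv j (fun θ : ℝ =>
        ∫ q in {q : ℝ × ℝ | |q.1| < π ∧ |q.2| < π ∧ |frameLevel μ K (WithLp.toLp 2 ![q.1, q.2])| < r},
          f (frameLevel μ K (WithLp.toLp 2 ![q.1, q.2])) * V (levelPoint μ K 0 θ) (WithLp.toLp 2 ![q.1, q.2])) θ =
      iteratedDeriv j (fun θ : ℝ =>
        ∫ q in {q : ℝ × ℝ | |q.1| < π ∧ |q.2| < π ∧ |frameLevel μ K (WithLp.toLp 2 ![q.1, q.2])| < r},
          f (frameLevel μ K (WithLp.toLp 2 ![q.1, q.2])) * (V (levelPoint μ K 0 θ) (WithLp.toLp 2 ![q.1, q.2]) - Vstar (WithLp.toLp 2 ![q.1, q.2]))) θ := by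
  have hfc : Continuous fun q : ℝ × ℝ => f (frameLevel μ K (WithLp.toLp 2 ![q.1, q.2])) :=
    hf.comp ((EngineV8.contDiff_frameLevel μ K (n := 0)).continuous.comp continuous_coordToLp)
  have hstar : IntegrableOn (fun q : ℝ × ℝ => f (frameLevel μ K (WithLp.toLp 2 ![q.1, q.2])) * Vstar (WithLp.toLp 2 ![q.1, q.2]))
      {q : ℝ × ℝ | |q.1| < π ∧ |q.2| < π ∧ |frameLevel μ K (WithLp.toLp 2 ![q.1, q.2])| < r} :=
    integrableOn_tube_of_continuous' μ K r (hfc.mul (hVstar.comp continuous_coordToLp))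
  have hdiff : ∀ θ' : ℝ, IntegrableOn (fun q : ℝ × ℝ => f (frameLevel μ K (WithLp.toLp 2 ![q.1, q.2])) *
      (V (levelPoint μ K 0 θ') (WithLp.toLp 2 ![q.1, q.2]) - Vstar (WithLp.toLp 2 ![q.1, q.2])))
      {q : ℝ × ℝ | |q.1| < π ∧ |q.2| < π ∧ |frameLevel μ K (WithLp.toLp 2 ![q.1, q.2])| < r} := fun θ' =>
    integrableOn_tube_of_continuous' μ K r (hfc.mul
      ((hV.comp (continuous_const.prodMk continuous_coordToLp)).sub (hVstar.comp continuous_coordToLp)))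
  have hfun : (fun θ : ℝ =>
        ∫ q in {q : ℝ × ℝ | |q.1| < π ∧ |q.2| < π ∧ |frameLevel μ K (WithLp.toLp 2 ![q.1, q.2])| < r},
          f (frameLevel μ K (WithLp.toLp 2 ![q.1, q.2])) * V (levelPoint μ K 0 θ) (WithLp.toLp 2 ![q.1, q.2])) =
      fun θ : ℝ => (∫ q in {q : ℝ × ℝ | |q.1| < π ∧ |q.2| < π ∧ |frameLevel μ K (WithLp.toLp 2 ![q.1, q.2])| < r},
          f (frameLevel μ K (WithLp.toLp 2 ![q.1, q.2])) * Vstar (WithLp.toLp 2 ![q.1, q.2])) +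
        ∫ q in {q : ℝ × ℝ | |q.1| < π ∧ |q.2| < π ∧ |frameLevel μ K (WithLp.toLp 2 ![q.1, q.2])| < r},
          f (frameLevel μ K (WithLp.toLp 2 ![q.1, q.2])) * (V (levelPoint μ K 0 θ) (WithLp.toLp 2 ![q.1, q.2]) - Vstar (WithLp.toLp 2 ![q.1, q.2])) := by
    funext θ'
    rw [← integral_add hstar (hdiff θ')]
    refine setIntegral_congr_fun ?_ fun q _ => by ring
    exact (measurableSet_lt (measurable_fst.abs) measurable_const).inter ((measurableSet_lt (measurable_snd.abs) measurable_const).inter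
      (measurableSet_lt (((EngineV8.contDiff_frameLevel μ K (n := 0)).continuous.comp continuous_coordToLp).measurable.abs) measurable_const))
  rw [hfun, iteratedDeriv_const_add hj]

end Blind

/-! ## §2 The one-line jets with a reference vertex subtracted -/

section Assembly

variable {L M : ℕ} [NeZero L] [NeZero M]
variable {a b : ℝ} (B : BandBounds a b) {K : TrigPolyC4v} {A : ℝ}
  (hA : ∀ p : Momentum, ∀ j ≤ 2, ‖iteratedFDeriv ℝ j (frameShift K) p‖ ≤ A) (hADt : 2 * A < B.Dtmin)
  {μ r : ℝ} (hr : 0 < r) (hlo : a < μ - r - A) (hhi : μ + r + A < b)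
include B hA hADt hr hlo hhi

/-- **THE ONE-LINE JETS ASSEMBLY, reference-subtracted.**  As `…C4aTadpoleJetAssembly.abs_iteratedDeriv_re_tadpoleCont_comp_le`, for `1 ≤ j ≤ N ≤ 4`, but the
(L3) input is `CoMovingJetsL1 N (aV p₀) r μ K (V_{p₀} − V★_{p₀})` for an arbitrary smooth θ-blind family `V★_{p₀} : Momentum → ℂ` (the bare / Hartree part drops):
`|∂_θʲ Re tadpoleCont(k_F^K θ)| ≤ (2π)⁻²·Σ_{p₀}(Σ_{i≤j} C(j,i)·G_i·Mv_{p₀,j−i})·∫_{(−r,r)}‖ŝ_{p₀}‖ + bell4 (k ↦ Lᵏ·mass·Σ_{p₀} tail_{p₀}) D j`.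
[cite: BenfattoGiulianiMastropietro2006, §2.4 (2.36)] -/
theorem abs_iteratedDeriv_re_tadpoleCont_comp_le_ref {β : ℝ} (hβ : β ≠ 0) {Λ Λ' : ℝ} (hΛ : 0 < Λ) (hΛΛ' : Λ ≤ Λ') (hΛr : Λ' < r)
    (W : HubbardGrassmann L M) {N : ℕ} (hN : N ≤ 4)
    {G : ℕ → ℝ} (hJjet : ∀ ρ, |ρ| < r → ∀ i ≤ N, ∀ s, ‖iteratedDeriv i (fun s => levelChartJac μ K (ρ, s)) s‖ ≤ G i)
    {Vstar : MatsubaraIdx M → Momentum → ℂ} (hVstar : ∀ p₀, ContDiff ℝ ∞ (Vstar p₀))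
    {aV : MatsubaraIdx M → ℕ → ℝ × ℝ → ℝ}
    (hVJ : ∀ p₀ : MatsubaraIdx M, CoMovingJetsL1 N (aV p₀) r μ K (fun k q => tadpoleVertex β W p₀ k q - Vstar p₀ q))
    {Mv : MatsubaraIdx M → ℕ → ℝ} (hMv : ∀ (p₀ : MatsubaraIdx M), ∀ i ≤ N, ∀ ρ ∈ Ioo (-r) r, ∫ ϑ in Ioc 0 (2 * π), aV p₀ i (ρ, ϑ) ≤ Mv p₀ i)
    {Mdeg : ℕ} (hM : 4 ≤ Mdeg) {Da : MatsubaraIdx M → ℝ}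
    (hDa : ∀ (p₀ : MatsubaraIdx M) (y : Momentum), ‖iteratedFDeriv ℝ Mdeg (fun y : Momentum =>
      sliceSymbolFnXi (β * (L : ℝ) ^ 2) 0 Λ Λ' (matsubaraFreq β M p₀) (frameLevel μ K ((2 * π) • y))) y‖ ≤ Da p₀)
    (hγ : ContDiff ℝ 4 fun θ : ℝ => (WithLp.toLp 2 (klFermiPoint μ K θ) : Momentum)) {θ : ℝ} {D : ℕ → ℝ}
    (hD : ∀ i, 1 ≤ i → i ≤ 4 → ‖iteratedDeriv i (fun θ : ℝ => (WithLp.toLp 2 (klFermiPoint μ K θ) : Momentum)) θ‖ ≤ D i)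
    {Mk : ℕ → ℝ}
    (hMk : ∀ k, Mk k = (L : ℝ) ^ k * (6 * |β| * (L : ℝ) ^ 4 * ∑ σ : Fin 2, ∑ τ : Fin 2, 2 * (((Fintype.card (SpaceTimeIdx L M) : ℝ) ^ 4)⁻¹ *
        ∑ x : Fin 4 → SpaceTimeIdx L M, ‖positionKernel L M β W 4 (fun i => ((x i, ![σ, σ, τ, τ] i), (![0, 1, 1, 0] : Fin 4 → Fin 2) i))‖)) *
          ∑ p₀ : MatsubaraIdx M, Da p₀ / (2 * Real.pi) ^ Mdeg * (2 / (L : ℝ)) ^ (Mdeg - 4) * (4 * ∑' k : Fin 2 → ℤ, ∏ j, (1 + (k j : ℝ) ^ 2)⁻¹))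
    {j : ℕ} (hj1 : 1 ≤ j) (hj : j ≤ N) :
    |iteratedDeriv j (fun θ : ℝ => (tadpoleCont β μ K Λ Λ' W (klFermiPoint μ K θ)).re) θ| ≤
      ((2 * π) ^ 2)⁻¹ * (∑ p₀ : MatsubaraIdx M, (∑ i ∈ Finset.range (j + 1), (j.choose i : ℝ) * G i * Mv p₀ (j - i)) *
          ∫ ρ in Ioo (-r) r, ‖sliceSymbolFnXi (β * (L : ℝ) ^ 2) 0 Λ Λ' (matsubaraFreq β M p₀) ρ‖) +
        bell4 Mk D j := by
  have hj4 : j ≤ 4 := hj.trans hN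
  -- the two pieces as named functions
  obtain ⟨TT, hTT⟩ : ∃ TT : MatsubaraIdx M → ℝ → ℂ, TT = fun p₀ θ =>
      ∫ q in {q : ℝ × ℝ | |q.1| < π ∧ |q.2| < π ∧ |frameLevel μ K (WithLp.toLp 2 ![q.1, q.2])| < r},
        sliceSymbolFnXi (β * (L : ℝ) ^ 2) 0 Λ Λ' (matsubaraFreq β M p₀) (frameLevel μ K (WithLp.toLp 2 ![q.1, q.2])) *
          tadpoleVertex β W p₀ (levelPoint μ K 0 θ) (WithLp.toLp 2 ![q.1, q.2]) := ⟨_, rfl⟩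
  obtain ⟨Al, hAl⟩ : ∃ Al : Momentum → ℂ, Al = fun P : Momentum =>
      ∑ p₀ : MatsubaraIdx M, ∑ y : TorusSite 2 L, tadpoleCoeff β W p₀ (WithLp.ofLp P) y * aliasErr β μ K Λ Λ' r p₀ y := ⟨_, rfl⟩
  have hTTcd : ∀ p₀, ContDiff ℝ ∞ (TT p₀) := fun p₀ => by
    rw [hTT]
    exact contDiff_tubeTadpole B hA hADt hr hlo hhi (sliceSymbolFnXi_matsubara_contDiff hβ L M p₀ Λ Λ')
      (sliceSymbolFnXi_matsubara_tsupport_subset L M p₀ hΛ hΛΛ' hΛr) (contDiff_tadpoleVertex β W p₀)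
  have hAlcd : ContDiff ℝ 4 Al := by rw [hAl]; exact contDiff_aliasSum β W _
  -- the decomposition along the curve
  have hdec : (fun θ : ℝ => (tadpoleCont β μ K Λ Λ' W (klFermiPoint μ K θ)).re) =
      fun θ : ℝ => (∑ p₀ : MatsubaraIdx M, ((((2 * π) ^ 2)⁻¹ : ℝ) : ℂ) * TT p₀ θ).re +
        ((fun P : Momentum => (Al P).re) ∘ fun θ : ℝ => (WithLp.toLp 2 (klFermiPoint μ K θ) : Momentum)) θ := by
    funext θ'
    rw [tadpoleCont_eq_tubeTadpoles_add_alias hβ μ K Λ Λ' r W, Complex.add_re, hTT, hAl]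
    simp only [Function.comp_apply, levelPoint_zero, Complex.real_smul]
  -- smoothness of the two pieces
  have hTT4 : ∀ p₀, ContDiff ℝ 4 (TT p₀) := fun p₀ => contDiff_infty.1 (hTTcd p₀) 4
  have hTTj : ∀ p₀, ContDiff ℝ j (TT p₀) := fun p₀ => (hTT4 p₀).of_le (by exact_mod_cast hj4)
  have hsum : ContDiff ℝ 4 fun θ : ℝ => ∑ p₀ : MatsubaraIdx M, ((((2 * π) ^ 2)⁻¹ : ℝ) : ℂ) * TT p₀ θ :=
    ContDiff.sum fun p₀ _ => contDiff_const.mul (hTT4 p₀)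
  have h1 : ContDiff ℝ 4 fun θ : ℝ => (∑ p₀ : MatsubaraIdx M, ((((2 * π) ^ 2)⁻¹ : ℝ) : ℂ) * TT p₀ θ).re :=
    Complex.reCLM.contDiff.comp hsum
  have h2 : ContDiff ℝ 4 ((fun P : Momentum => (Al P).re) ∘ fun θ : ℝ => (WithLp.toLp 2 (klFermiPoint μ K θ) : Momentum)) :=
    (Complex.reCLM.contDiff.comp hAlcd).comp hγ
  rw [hdec, iteratedDeriv_fun_add (h1.contDiffAt.of_le (by exact_mod_cast hj4)) (h2.contDiffAt.of_le (by exact_mod_cast hj4))]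
  refine (abs_add_le _ _).trans (add_le_add ?_ ?_)
  · -- the tube tadpoles
    refine (abs_iteratedDeriv_re_le (hsum.of_le (by exact_mod_cast hj4)) θ).trans ?_
    rw [iteratedDeriv_fun_sum fun p₀ _ => ((contDiff_const.mul (hTTj p₀)).contDiffAt :
      ContDiffAt ℝ j (fun θ => ((((2 * π) ^ 2)⁻¹ : ℝ) : ℂ) * TT p₀ θ) θ)]
    refine (norm_sum_le _ _).trans ?_
    rw [Finset.mul_sum]
    refine Finset.sum_le_sum fun p₀ _ => ?_
    rw [iteratedDeriv_const_mul _ (hTTj p₀).contDiffAt, norm_mul,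
      Complex.norm_real, Real.norm_of_nonneg (by positivity)]
    refine mul_le_mul_of_nonneg_left ?_ (by positivity)
    rw [hTT, iteratedDeriv_tubeTadpole_eq_sub_blind μ K r (sliceSymbolFnXi_matsubara_contDiff hβ L M p₀ Λ Λ').continuous
      (contDiff_tadpoleVertex β W p₀).continuous (hVstar p₀).continuous hj1 θ]
    have hVd : ContDiff ℝ ∞ fun x : Momentum × Momentum => (fun k q => tadpoleVertex β W p₀ k q - Vstar p₀ q) x.1 x.2 :=
      (contDiff_tadpoleVertex β W p₀).sub ((hVstar p₀).comp contDiff_snd)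
    exact norm_iteratedDeriv_tubeTadpole_le_of_L1_unif B hA hADt hr hlo hhi (sliceSymbolFnXi_matsubara_contDiff hβ L M p₀ Λ Λ')
      (sliceSymbolFnXi_matsubara_tsupport_subset L M p₀ hΛ hΛΛ' hΛr) hJjet hVd (hVJ p₀) (hMv p₀) hj θ
  · -- the aliasing term
    rw [hAl]
    exact abs_iteratedDeriv_re_aliasSum_comp_le_bell4 W
      (fun p₀ y => norm_aliasErr_le hβ μ K hΛ hΛΛ' hΛr p₀ hM (hDa p₀) y) hγ hD hMk hj4

/-! ## §3 The (A) capstone with a reference vertex subtracted -/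

/-- **THE (A) CAPSTONE, reference-subtracted form.**  As `…C4aSliceIncrementAssembly.twoLegCurveJetBound_succ_of_inputs_value` (value line `V₀`, tube-jet fit for
`1 ≤ k ≤ 4`), with the (L3) dominators asked of `tadpoleVertex β 𝒱_n p₀ − V★_{p₀}` only. [cite: BenfattoGiulianiMastropietro2006, §2.4 (2.36)] -/
theorem twoLegCurveJetBound_succ_of_inputs_ref {β : ℝ} (hβ : β ≠ 0) (U : ℝ) (n : ℕ)
    (hΛ : 0 < klScale klE0 (n + 1)) (hΛΛ' : klScale klE0 (n + 1) ≤ klScale klE0 n) (hΛr : klScale klE0 n < r)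
    (hZ : hubbardEffPartitionFnCT L M β U μ 0 K (klScale klE0 n) ≠ 0)
    {G : ℕ → ℝ} (hJjet : ∀ ρ, |ρ| < r → ∀ i ≤ 4, ∀ s, ‖iteratedDeriv i (fun s => levelChartJac μ K (ρ, s)) s‖ ≤ G i)
    {Vstar : MatsubaraIdx M → Momentum → ℂ} (hVstar : ∀ p₀, ContDiff ℝ ∞ (Vstar p₀))
    {aV : MatsubaraIdx M → ℕ → ℝ × ℝ → ℝ}
    (hVJ : ∀ p₀ : MatsubaraIdx M, CoMovingJetsL1 4 (aV p₀) r μ K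
      (fun k q => tadpoleVertex β (klEffectiveAction L M β U μ K klE0 n) p₀ k q - Vstar p₀ q))
    {Mv : MatsubaraIdx M → ℕ → ℝ} (hMv : ∀ (p₀ : MatsubaraIdx M), ∀ i ≤ 4, ∀ ρ ∈ Ioo (-r) r, ∫ ϑ in Ioc 0 (2 * π), aV p₀ i (ρ, ϑ) ≤ Mv p₀ i)
    {Mdeg : ℕ} (hM : 4 ≤ Mdeg) {Da : MatsubaraIdx M → ℝ}
    (hDa : ∀ (p₀ : MatsubaraIdx M) (y : Momentum), ‖iteratedFDeriv ℝ Mdeg (fun y : Momentum =>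
      sliceSymbolFnXi (β * (L : ℝ) ^ 2) 0 (klScale klE0 (n + 1)) (klScale klE0 n) (matsubaraFreq β M p₀) (frameLevel μ K ((2 * π) • y))) y‖ ≤ Da p₀)
    (hγ : ContDiff ℝ 4 fun θ : ℝ => (WithLp.toLp 2 (klFermiPoint μ K θ) : Momentum)) {D : ℕ → ℝ}
    (hD : ∀ θ : ℝ, ∀ i, 1 ≤ i → i ≤ 4 → ‖iteratedDeriv i (fun θ : ℝ => (WithLp.toLp 2 (klFermiPoint μ K θ) : Momentum)) θ‖ ≤ D i)
    {Mk : ℕ → ℝ}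
    (hMk : ∀ k, Mk k = (L : ℝ) ^ k * (6 * |β| * (L : ℝ) ^ 4 * ∑ σ : Fin 2, ∑ τ : Fin 2, 2 * (((Fintype.card (SpaceTimeIdx L M) : ℝ) ^ 4)⁻¹ *
        ∑ x : Fin 4 → SpaceTimeIdx L M, ‖positionKernel L M β (klEffectiveAction L M β U μ K klE0 n) 4
          (fun i => ((x i, ![σ, σ, τ, τ] i), (![0, 1, 1, 0] : Fin 4 → Fin 2) i))‖)) *
          ∑ p₀ : MatsubaraIdx M, Da p₀ / (2 * Real.pi) ^ Mdeg * (2 / (L : ℝ)) ^ (Mdeg - 4) * (4 * ∑' k : Fin 2 → ℤ, ∏ j, (1 + (k j : ℝ) ^ 2)⁻¹))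
    -- the one-line VALUE bound, uniformly in the angle
    {V₀ : ℝ} (hV₀ : ∀ θ : ℝ, |(tadpoleCont β μ K (klScale klE0 (n + 1)) (klScale klE0 n) (klEffectiveAction L M β U μ K klE0 n) (klFermiPoint μ K θ)).re| ≤ V₀)
    {c c' : ℕ → ℝ}
    (hfit0 : V₀ +
        bell4 (twoPointMoment β
          (gaussConv ℂ (hubbardCovSliceCT L M β μ 0 K (klScale klE0 (n + 1)) (klScale klE0 n)) (klEffectiveAction L M β U μ K klE0 n) -
            klEffectiveAction L M β U μ K klE0 n -
            grassmannLaplacian ℂ (hubbardCovSliceCT L M β μ 0 K (klScale klE0 (n + 1)) (klScale klE0 n))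
              (klEffectiveAction L M β U μ K klE0 n))) D 0 +
        bell4 (twoPointMoment β
          (effAction ℂ (hubbardCovSliceCT L M β μ 0 K (klScale klE0 (n + 1)) (klScale klE0 n)) (klEffectiveAction L M β U μ K klE0 n) -
            gaussConv ℂ (hubbardCovSliceCT L M β μ 0 K (klScale klE0 (n + 1)) (klScale klE0 n)) (klEffectiveAction L M β U μ K klE0 n))) D 0 ≤
      curveJetBar c c' U 0 (n + 1))
    (hfit : ∀ k, 1 ≤ k → k ≤ 4 →
      ((2 * π) ^ 2)⁻¹ * (∑ p₀ : MatsubaraIdx M, (∑ i ∈ Finset.range (k + 1), (k.choose i : ℝ) * G i * Mv p₀ (k - i)) *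
          ∫ ρ in Ioo (-r) r, ‖sliceSymbolFnXi (β * (L : ℝ) ^ 2) 0 (klScale klE0 (n + 1)) (klScale klE0 n) (matsubaraFreq β M p₀) ρ‖) +
        bell4 Mk D k +
        bell4 (twoPointMoment β
          (gaussConv ℂ (hubbardCovSliceCT L M β μ 0 K (klScale klE0 (n + 1)) (klScale klE0 n)) (klEffectiveAction L M β U μ K klE0 n) -
            klEffectiveAction L M β U μ K klE0 n -
            grassmannLaplacian ℂ (hubbardCovSliceCT L M β μ 0 K (klScale klE0 (n + 1)) (klScale klE0 n))
              (klEffectiveAction L M β U μ K klE0 n))) D k +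
        bell4 (twoPointMoment β
          (effAction ℂ (hubbardCovSliceCT L M β μ 0 K (klScale klE0 (n + 1)) (klScale klE0 n)) (klEffectiveAction L M β U μ K klE0 n) -
            gaussConv ℂ (hubbardCovSliceCT L M β μ 0 K (klScale klE0 (n + 1)) (klScale klE0 n)) (klEffectiveAction L M β U μ K klE0 n))) D k ≤
      curveJetBar c c' U k (n + 1)) :
    TwoLegCurveJetBound L M c c' β U μ K (n + 1) := by
  have hlo' : a ≤ μ - A := by linarith
  have hhi' : μ + A ≤ b := by linarith
  obtain ⟨W, hW⟩ : ∃ W : HubbardGrassmann L M, W = klEffectiveAction L M β U μ K klE0 n := ⟨_, rfl⟩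
  obtain ⟨R₁, hR₁⟩ : ∃ R₁ : HubbardGrassmann L M, R₁ =
      gaussConv ℂ (hubbardCovSliceCT L M β μ 0 K (klScale klE0 (n + 1)) (klScale klE0 n)) (klEffectiveAction L M β U μ K klE0 n) -
        klEffectiveAction L M β U μ K klE0 n -
        grassmannLaplacian ℂ (hubbardCovSliceCT L M β μ 0 K (klScale klE0 (n + 1)) (klScale klE0 n)) (klEffectiveAction L M β U μ K klE0 n) :=
    ⟨_, rfl⟩
  obtain ⟨R₂, hR₂⟩ : ∃ R₂ : HubbardGrassmann L M, R₂ =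
      effAction ℂ (hubbardCovSliceCT L M β μ 0 K (klScale klE0 (n + 1)) (klScale klE0 n)) (klEffectiveAction L M β U μ K klE0 n) -
        gaussConv ℂ (hubbardCovSliceCT L M β μ 0 K (klScale klE0 (n + 1)) (klScale klE0 n)) (klEffectiveAction L M β U μ K klE0 n) := ⟨_, rfl⟩
  rw [← hW] at hVJ hMk hV₀
  rw [← hR₁, ← hR₂] at hfit hfit0
  set T : (Fin 2 → ℝ) → ℂ := fun P =>
    tadpoleCont β μ K (klScale klE0 (n + 1)) (klScale klE0 n) W P + localReadingCont β R₁ P + localReadingCont β R₂ P with hTdef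
  have hT : T = fun P =>
      tadpoleCont β μ K (klScale klE0 (n + 1)) (klScale klE0 n) (klEffectiveAction L M β U μ K klE0 n) P +
        localReadingCont β
          (gaussConv ℂ (hubbardCovSliceCT L M β μ 0 K (klScale klE0 (n + 1)) (klScale klE0 n)) (klEffectiveAction L M β U μ K klE0 n) -
            klEffectiveAction L M β U μ K klE0 n -
            grassmannLaplacian ℂ (hubbardCovSliceCT L M β μ 0 K (klScale klE0 (n + 1)) (klScale klE0 n))
              (klEffectiveAction L M β U μ K klE0 n)) P +
        localReadingCont β
          (effAction ℂ (hubbardCovSliceCT L M β μ 0 K (klScale klE0 (n + 1)) (klScale klE0 n)) (klEffectiveAction L M β U μ K klE0 n) -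
            gaussConv ℂ (hubbardCovSliceCT L M β μ 0 K (klScale klE0 (n + 1)) (klScale klE0 n)) (klEffectiveAction L M β U μ K klE0 n)) P := by
    rw [hTdef, hW, hR₁, hR₂]
  have h1 : ContDiff ℝ 4 fun θ : ℝ => (tadpoleCont β μ K (klScale klE0 (n + 1)) (klScale klE0 n) W (klFermiPoint μ K θ)).re :=
    IsCharPoly.contDiff_re_comp_klFermiPoint B hA hADt hlo' hhi' (isCharPoly_tadpoleCont β μ K _ _ W)
  have h2 : ContDiff ℝ 4 fun θ : ℝ => (localReadingCont β R₁ (klFermiPoint μ K θ)).re :=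
    IsCharPoly.contDiff_re_comp_klFermiPoint B hA hADt hlo' hhi' (isCharPoly_localReadingCont β R₁)
  have h3 : ContDiff ℝ 4 fun θ : ℝ => (localReadingCont β R₂ (klFermiPoint μ K θ)).re :=
    IsCharPoly.contDiff_re_comp_klFermiPoint B hA hADt hlo' hhi' (isCharPoly_localReadingCont β R₂)
  have hsplit : (fun θ' : ℝ => (T (klFermiPoint μ K θ')).re) = fun θ' : ℝ =>
      (tadpoleCont β μ K (klScale klE0 (n + 1)) (klScale klE0 n) W (klFermiPoint μ K θ')).re +
        (localReadingCont β R₁ (klFermiPoint μ K θ')).re + (localReadingCont β R₂ (klFermiPoint μ K θ')).re := by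
    funext θ'
    rw [hTdef]
    simp only [Complex.add_re]
  refine twoLegCurveJetBound_succ_of_jets B hA hADt hlo' hhi' hβ U n hZ hT fun k hk θ => ?_
  have hk' : (k : WithTop ℕ∞) ≤ 4 := by exact_mod_cast hk
  rw [hsplit, iteratedDeriv_fun_add ((h1.add h2).contDiffAt.of_le hk') (h3.contDiffAt.of_le hk'),
    iteratedDeriv_fun_add (h1.contDiffAt.of_le hk') (h2.contDiffAt.of_le hk')]
  refine (abs_add_le _ _).trans ((add_le_add ((abs_add_le _ _).trans (add_le_add le_rfl
    (abs_iteratedDeriv_re_localReadingCont_klFermiPoint_le β μ K R₁ hγ (hD θ) hk)))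
    (abs_iteratedDeriv_re_localReadingCont_klFermiPoint_le β μ K R₂ hγ (hD θ) hk)).trans ?_)
  rcases Nat.eq_zero_or_pos k with hk0 | hk1
  · subst hk0
    simp only [iteratedDeriv_zero]
    exact le_trans (by linarith [hV₀ θ]) hfit0
  · have htad := abs_iteratedDeriv_re_tadpoleCont_comp_le_ref B hA hADt hr hlo hhi hβ hΛ hΛΛ' hΛr W le_rfl hJjet hVstar hVJ hMv hM hDa hγ (hD θ) hMk hk1 hk
    exact le_trans (by linarith [htad]) (hfit k hk1 hk)

end Assembly

end Summit.HubbardSuperconductivity.HubbardSuperconductivity.Theorems.C4a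

end
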